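import Mathlib.Data.Complex.Basic
import Mathlib.Tactic.Linarith
import Mathlib.Tactic.LinearCombination
import Mathlib.Tactic.Positivity
import HarnessLib

/-!
# Winding numbers of closed walks on the triangular lattice, IV: lattice unit segments meet only at endpoints

Fourth proof file for the registered stub `stub_pickParity` of line `charged-uncharged` of crux
`ZeroOneTransfer` (stmt-ValiantsHypothesis-5066, route DivisionGap).  Elementary plane geometry of
the triangular lattice drawn on `ℤ²` with antidiagonals (unit steps `±(1,0)`, `±(0,1)`, `±(1,-1)`),
in coordinates (a point of the closed segment `[p, p + d]` is `p + s·d`, `s ∈ [0,1]`):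

* the three step directions are pairwise UNIMODULAR (`cross_step_cases`: the cross product of two
  steps is `±1`, or the steps are parallel), so a common point of two closed unit segments has
  integer parameters on both (`endpoint_of_meet_cross`), and parallel segments are compared along a
  `±1` coordinate (`endpoint_of_meet_par`, `endpoint_of_meet_anti`);
* **closed unit segments meet only at common endpoints** (`endpoint_of_meet`, registered sub-goal
  `pickParity_endpoint_of_meet`), and two DISTINCT steps out of one lattice point meet only there
  (`param_eq_zero_of_meet`).
These give the simplicity hypotheses of the tree's polygonal Umlaufsatz for simple lattice walks
(`…StubPickParityAux5.lean`). [folklore]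
-/

namespace Summit.ValiantsHypothesis.ValiantsHypothesis.Theorems.DivisionGapZeroOneTransfer

-- the single-problem summit's namespace `Summit.ValiantsHypothesis.ValiantsHypothesis` repeats
set_option linter.dupNamespace false

/-! ### Lattice unit segments meet only at common endpoints -/

/-- An integer squeezed in a real interval with integer ends. [folklore] -/
theorem int_bounds_of_real {k lo hi : ℤ} {x : ℝ} (h : (k : ℝ) = x) (h0 : (lo : ℝ) ≤ x)
    (h1 : x ≤ hi) : lo ≤ k ∧ k ≤ hi := by
  subst h
  exact ⟨by exact_mod_cast h0, by exact_mod_cast h1⟩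

/-- The cross product of two unit steps of the triangular lattice is `±1`, or the steps are
parallel. [folklore] -/
theorem cross_step_cases {d e : ℤ × ℤ}
    (hd : d = (1, 0) ∨ d = (-1, 0) ∨ d = (0, 1) ∨ d = (0, -1) ∨ d = (1, -1) ∨ d = (-1, 1))
    (he : e = (1, 0) ∨ e = (-1, 0) ∨ e = (0, 1) ∨ e = (0, -1) ∨ e = (1, -1) ∨ e = (-1, 1)) :
    d.1 * e.2 - d.2 * e.1 = 1 ∨ d.1 * e.2 - d.2 * e.1 = -1 ∨ e = d ∨ e = -d := by
  rcases hd with rfl | rfl | rfl | rfl | rfl | rfl <;>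
  rcases he with rfl | rfl | rfl | rfl | rfl | rfl <;> decide

/-- Two unit steps `p → p + d`, `q → q + e` of the triangular lattice with NON-PARALLEL directions
whose closed segments meet do so at a common endpoint. [folklore] -/
theorem endpoint_of_meet_cross {p q d e : ℤ × ℤ} (hcr : d.1 * e.2 - d.2 * e.1 = 1 ∨ d.1 * e.2 - d.2 * e.1 = -1)
    {s t : ℝ} (hs : 0 ≤ s ∧ s ≤ 1) (ht : 0 ≤ t ∧ t ≤ 1)
    (h1 : (p.1 : ℝ) + s * d.1 = q.1 + t * e.1) (h2 : (p.2 : ℝ) + s * d.2 = q.2 + t * e.2) :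
    p = q ∨ p = q + e ∨ p + d = q ∨ p + d = q + e := by
  set cr : ℤ := d.1 * e.2 - d.2 * e.1 with hcr_def
  have hc2 : ((cr : ℤ) : ℝ) ^ 2 = 1 := by
    rcases hcr with h | h <;> · rw [h]; norm_num
  -- `s` and `t` are integers
  have hs_cr : s * cr = ((q.1 : ℝ) - p.1) * e.2 - ((q.2 : ℝ) - p.2) * e.1 := by
    rw [hcr_def]; push_cast; linear_combination (e.2 : ℝ) * h1 - (e.1 : ℝ) * h2
  have ht_cr : t * cr = ((q.1 : ℝ) - p.1) * d.2 - ((q.2 : ℝ) - p.2) * d.1 := by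
    rw [hcr_def]; push_cast; linear_combination (d.2 : ℝ) * h1 - (d.1 : ℝ) * h2
  obtain ⟨m, hsm⟩ : ∃ m : ℤ, (m : ℝ) = s :=
    ⟨cr * ((q.1 - p.1) * e.2 - (q.2 - p.2) * e.1), by
      push_cast
      rw [← hs_cr]
      calc (cr : ℝ) * (s * cr) = s * (cr : ℝ) ^ 2 := by ring
        _ = s := by rw [hc2, mul_one]⟩
  obtain ⟨n, htn⟩ : ∃ n : ℤ, (n : ℝ) = t :=
    ⟨cr * ((q.1 - p.1) * d.2 - (q.2 - p.2) * d.1), by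
      push_cast
      rw [← ht_cr]
      calc (cr : ℝ) * (t * cr) = t * (cr : ℝ) ^ 2 := by ring
        _ = t := by rw [hc2, mul_one]⟩
  have hm01 := int_bounds_of_real (lo := 0) (hi := 1) hsm (by exact_mod_cast hs.1) (by exact_mod_cast hs.2)
  have hn01 := int_bounds_of_real (lo := 0) (hi := 1) htn (by exact_mod_cast ht.1) (by exact_mod_cast ht.2)
  rw [← hsm, ← htn] at h1 h2
  have e1 : p.1 + m * d.1 = q.1 + n * e.1 := by exact_mod_cast h1
  have e2 : p.2 + m * d.2 = q.2 + n * e.2 := by exact_mod_cast h2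
  obtain ⟨p1, p2⟩ := p; obtain ⟨q1, q2⟩ := q; obtain ⟨d1, d2⟩ := d; obtain ⟨e1', e2'⟩ := e
  simp only [Prod.ext_iff, Prod.fst_add, Prod.snd_add] at e1 e2 ⊢
  rcases (show m = 0 ∨ m = 1 by omega) with rfl | rfl <;>
  rcases (show n = 0 ∨ n = 1 by omega) with rfl | rfl <;> omega

/-- Two unit steps of the triangular lattice in the SAME direction whose closed segments meet do
so at a common endpoint. [folklore] -/
theorem endpoint_of_meet_par {p q d : ℤ × ℤ}
    (hd : d = (1, 0) ∨ d = (-1, 0) ∨ d = (0, 1) ∨ d = (0, -1) ∨ d = (1, -1) ∨ d = (-1, 1))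
    {s t : ℝ} (hs : 0 ≤ s ∧ s ≤ 1) (ht : 0 ≤ t ∧ t ≤ 1)
    (h1 : (p.1 : ℝ) + s * d.1 = q.1 + t * d.1) (h2 : (p.2 : ℝ) + s * d.2 = q.2 + t * d.2) :
    p = q ∨ p = q + d ∨ p + d = q ∨ p + d = q + d := by
  obtain ⟨p1, p2⟩ := p; obtain ⟨q1, q2⟩ := q
  -- in every case one coordinate of `d` is `±1`, which makes `s - t` an integer `μ ∈ [-1, 1]`
  have main : ∀ μ : ℤ, (μ : ℝ) = s - t → ((q1, q2) : ℤ × ℤ) = (p1, p2) + μ • d →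
      (p1, p2) = (q1, q2) ∨ (p1, p2) = (q1, q2) + d ∨ (p1, p2) + d = (q1, q2) ∨
        (p1, p2) + d = (q1, q2) + d := by
    intro μ hμ hq
    have hb := int_bounds_of_real (lo := -1) (hi := 1) hμ (by push_cast; linarith [hs.1, ht.2])
      (by push_cast; linarith [hs.2, ht.1])
    obtain ⟨d1, d2⟩ := d
    simp only [Prod.ext_iff, Prod.fst_add, Prod.snd_add, Prod.smul_mk, smul_eq_mul] at hq ⊢
    rcases (show μ = -1 ∨ μ = 0 ∨ μ = 1 by omega) with rfl | rfl | rfl <;> omega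
  rcases hd with rfl | rfl | rfl | rfl | rfl | rfl <;> simp only at h1 h2 <;> push_cast at h1 h2
  · refine main (q1 - p1) (by push_cast; linarith) ?_
    have : (p2 : ℝ) = q2 := by linarith
    have h' : p2 = q2 := by exact_mod_cast this
    simp [h']
  · refine main (p1 - q1) (by push_cast; linarith) ?_
    have : (p2 : ℝ) = q2 := by linarith
    have h' : p2 = q2 := by exact_mod_cast this
    simp [h']
  · refine main (q2 - p2) (by push_cast; linarith) ?_
    have : (p1 : ℝ) = q1 := by linarith
    have h' : p1 = q1 := by exact_mod_cast this
    simp [h']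
  · refine main (p2 - q2) (by push_cast; linarith) ?_
    have : (p1 : ℝ) = q1 := by linarith
    have h' : p1 = q1 := by exact_mod_cast this
    simp [h']
  · refine main (q1 - p1) (by push_cast; linarith) ?_
    have : ((p1 + p2 : ℤ) : ℝ) = q1 + q2 := by push_cast; linarith
    have h' : p1 + p2 = q1 + q2 := by exact_mod_cast this
    simp [Prod.ext_iff]; omega
  · refine main (p1 - q1) (by push_cast; linarith) ?_
    have : ((p1 + p2 : ℤ) : ℝ) = q1 + q2 := by push_cast; linarith
    have h' : p1 + p2 = q1 + q2 := by exact_mod_cast this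
    simp [Prod.ext_iff]; omega

/-- Two unit steps of the triangular lattice in OPPOSITE directions whose closed segments meet do
so at a common endpoint. [folklore] -/
theorem endpoint_of_meet_anti {p q d : ℤ × ℤ}
    (hd : d = (1, 0) ∨ d = (-1, 0) ∨ d = (0, 1) ∨ d = (0, -1) ∨ d = (1, -1) ∨ d = (-1, 1))
    {s t : ℝ} (hs : 0 ≤ s ∧ s ≤ 1) (ht : 0 ≤ t ∧ t ≤ 1)
    (h1 : (p.1 : ℝ) + s * d.1 = q.1 + t * (-d).1) (h2 : (p.2 : ℝ) + s * d.2 = q.2 + t * (-d).2) :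
    p = q ∨ p = q + -d ∨ p + d = q ∨ p + d = q + -d := by
  obtain ⟨p1, p2⟩ := p; obtain ⟨q1, q2⟩ := q
  have main : ∀ μ : ℤ, (μ : ℝ) = s + t → ((q1, q2) : ℤ × ℤ) = (p1, p2) + μ • d →
      (p1, p2) = (q1, q2) ∨ (p1, p2) = (q1, q2) + -d ∨ (p1, p2) + d = (q1, q2) ∨
        (p1, p2) + d = (q1, q2) + -d := by
    intro μ hμ hq
    have hb := int_bounds_of_real (lo := 0) (hi := 2) hμ (by push_cast; linarith [hs.1, ht.1])
      (by push_cast; linarith [hs.2, ht.2])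
    obtain ⟨d1, d2⟩ := d
    simp only [Prod.ext_iff, Prod.fst_add, Prod.snd_add, Prod.smul_mk, smul_eq_mul, Prod.neg_mk] at hq ⊢
    rcases (show μ = 0 ∨ μ = 1 ∨ μ = 2 by omega) with rfl | rfl | rfl <;> omega
  rcases hd with rfl | rfl | rfl | rfl | rfl | rfl <;> simp only [Prod.neg_mk] at h1 h2 <;>
    push_cast at h1 h2
  · refine main (q1 - p1) (by push_cast; linarith) ?_
    have : (p2 : ℝ) = q2 := by linarith
    have h' : p2 = q2 := by exact_mod_cast this
    simp [h']
  · refine main (p1 - q1) (by push_cast; linarith) ?_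
    have : (p2 : ℝ) = q2 := by linarith
    have h' : p2 = q2 := by exact_mod_cast this
    simp [h']
  · refine main (q2 - p2) (by push_cast; linarith) ?_
    have : (p1 : ℝ) = q1 := by linarith
    have h' : p1 = q1 := by exact_mod_cast this
    simp [h']
  · refine main (p2 - q2) (by push_cast; linarith) ?_
    have : (p1 : ℝ) = q1 := by linarith
    have h' : p1 = q1 := by exact_mod_cast this
    simp [h']
  · refine main (q1 - p1) (by push_cast; linarith) ?_
    have : ((p1 + p2 : ℤ) : ℝ) = q1 + q2 := by push_cast; linarith
    have h' : p1 + p2 = q1 + q2 := by exact_mod_cast this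
    simp [Prod.ext_iff]; omega
  · refine main (p1 - q1) (by push_cast; linarith) ?_
    have : ((p1 + p2 : ℤ) : ℝ) = q1 + q2 := by push_cast; linarith
    have h' : p1 + p2 = q1 + q2 := by exact_mod_cast this
    simp [Prod.ext_iff]; omega

/-- **Closed unit segments of the triangular lattice meet only at common endpoints**: if the
segments `[p, p + d]` and `[q, q + e]` (unit steps `d`, `e`) have a common point, then one of the
four endpoint coincidences `p = q`, `p = q + e`, `p + d = q`, `p + d = q + e` holds. [folklore] -/
theorem endpoint_of_meet {p q d e : ℤ × ℤ}
    (hd : d = (1, 0) ∨ d = (-1, 0) ∨ d = (0, 1) ∨ d = (0, -1) ∨ d = (1, -1) ∨ d = (-1, 1))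
    (he : e = (1, 0) ∨ e = (-1, 0) ∨ e = (0, 1) ∨ e = (0, -1) ∨ e = (1, -1) ∨ e = (-1, 1))
    {s t : ℝ} (hs : 0 ≤ s ∧ s ≤ 1) (ht : 0 ≤ t ∧ t ≤ 1)
    (h1 : (p.1 : ℝ) + s * d.1 = q.1 + t * e.1) (h2 : (p.2 : ℝ) + s * d.2 = q.2 + t * e.2) :
    p = q ∨ p = q + e ∨ p + d = q ∨ p + d = q + e := by
  rcases cross_step_cases hd he with h | h | rfl | rfl
  · exact endpoint_of_meet_cross (Or.inl h) hs ht h1 h2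
  · exact endpoint_of_meet_cross (Or.inr h) hs ht h1 h2
  · exact endpoint_of_meet_par hd hs ht h1 h2
  · exact endpoint_of_meet_anti hd hs ht h1 h2

/-- Two DISTINCT unit steps `d ≠ e` out of one lattice point meet only at that point: if
`s·d = t·e` with `s, t ∈ [0, 1]` then `s = 0`. [folklore] -/
theorem param_eq_zero_of_meet {d e : ℤ × ℤ}
    (hd : d = (1, 0) ∨ d = (-1, 0) ∨ d = (0, 1) ∨ d = (0, -1) ∨ d = (1, -1) ∨ d = (-1, 1))
    (he : e = (1, 0) ∨ e = (-1, 0) ∨ e = (0, 1) ∨ e = (0, -1) ∨ e = (1, -1) ∨ e = (-1, 1))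
    (hne : d ≠ e) {s t : ℝ} (hs : 0 ≤ s ∧ s ≤ 1) (ht : 0 ≤ t ∧ t ≤ 1)
    (h1 : s * d.1 = t * e.1) (h2 : s * d.2 = t * e.2) : s = 0 := by
  rcases cross_step_cases hd he with h | h | rfl | rfl
  · have key : s * (d.1 * e.2 - d.2 * e.1 : ℤ) = 0 := by
      push_cast; linear_combination (e.2 : ℝ) * h1 - (e.1 : ℝ) * h2
    rw [h] at key; simpa using key
  · have key : s * (d.1 * e.2 - d.2 * e.1 : ℤ) = 0 := by
      push_cast; linear_combination (e.2 : ℝ) * h1 - (e.1 : ℝ) * h2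
    rw [h] at key; simpa using key
  · exact absurd rfl hne
  · -- `e = -d`: `(s + t) d = 0` with `d ≠ 0`
    obtain ⟨d1, d2⟩ := d
    simp only [Prod.neg_mk, Int.cast_neg] at h1 h2
    have hst1 : (s + t) * d1 = 0 := by linear_combination h1
    have hst2 : (s + t) * d2 = 0 := by linear_combination h2
    have hd0 : (d1 : ℝ) ≠ 0 ∨ (d2 : ℝ) ≠ 0 := by
      rcases hd with h | h | h | h | h | h <;> simp only [Prod.mk.injEq] at h <;> obtain ⟨rfl, rfl⟩ := h <;>
        norm_num
    rcases hd0 with h0 | h0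
    · have := (mul_eq_zero.1 hst1).resolve_right h0; linarith [hs.1, ht.1]
    · have := (mul_eq_zero.1 hst2).resolve_right h0; linarith [hs.1, ht.1]


/-- **Closed unit segments of the triangular lattice meet only at common endpoints** (closed form
of `endpoint_of_meet`; registered sub-goal `pickParity_endpoint_of_meet` of
stmt-ValiantsHypothesis-5066, a milestone of stub `stub_pickParity`). [folklore] -/
theorem pickParity_endpoint_of_meet : ∀ {p q d e : ℤ × ℤ}, (d = (1, 0) ∨ d = (-1, 0) ∨ d = (0, 1) ∨ d = (0, -1) ∨ d = (1, -1) ∨ d = (-1, 1)) → (e = (1, 0) ∨ e = (-1, 0) ∨ e = (0, 1) ∨ e = (0, -1) ∨ e = (1, -1) ∨ e = (-1, 1)) → ∀ {s t : ℝ}, (0 ≤ s ∧ s ≤ 1) → (0 ≤ t ∧ t ≤ 1) → (p.1 : ℝ) + s * d.1 = q.1 + t * e.1 → (p.2 : ℝ) + s * d.2 = q.2 + t * e.2 → p = q ∨ p = q + e ∨ p + d = q ∨ p + d = q + e :=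
  fun hd he _ _ hs ht h1 h2 => endpoint_of_meet hd he hs ht h1 h2

end Summit.ValiantsHypothesis.ValiantsHypothesis.Theorems.DivisionGapZeroOneTransfer
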